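import Summits.RiemannHypothesis.RiemannHypothesis.Theorems.WeilColumnBSplineMoment
import Summits.RiemannHypothesis.RiemannHypothesis.Theorems.WeilColumnThetaProfileDeriv
import Summits.RiemannHypothesis.RiemannHypothesis.Theorems.WeilColumnPoissonMajorant
import Summits.RiemannHypothesis.RiemannHypothesis.Theorems.WeilColumnBSplineContinuity
import Literature.NumberTheory.LFunctions.DeterminantEquationDFITheorem1
import HarnessLib

/-!
# D2: the derivative majorant `‖u·Θ′(u)‖ ≤ M₁·(u/u₁)^{m−1}` of the PART XIX theta series (RH-FREE)

WEIL column (LADDER-RH, W-P(P2); tier-1 `ThetaCertificateSound`, analytic layer D2 of THETA-ASSIGN v1.0 §3; this seat's assignment).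
* §2 `norm_fourier_momentProfile_le`: for `φ(y) = y·h′(y)` (`h′ = profileDeriv`, `WeilColumnThetaProfileDeriv`),
  `‖𝓕φ(ξ)‖ ≤ (2+2α)·X^m·(c₂ + ε(1+X))`, `X = m/(2πε|ξ|)` (THETA-CERT §D2's `|φ̂|`), and `fourier_momentProfile_zero : 𝓕φ(0) = 0`
  (`∫φ = −∫h = 0` by the choice of `α`) — inputs `WeilColumnBSplineMoment` (chain-rule moment bound, shift rule);
* §4 `summable_tsum_norm_le_of_lattice_bound` (lattice version of p416577's decay-to-sum lemma) and
  **`ThetaParams.norm_mul_deriv_Θ_le`**: `‖u·deriv P.Θ u‖ ≤ P.M₁·(u/P.u₁)^(m−1)` for `0 < u ≤ u₁` (Poisson majorant p414433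
  applied to `φ(·/λ)`; for `u ≤ u₁` and `|n| ≥ 1`, `X ≤ m/ζ⋆`), with `ThetaParams.hasDerivAt_Θ`.
B-spline continuity (m ≥ 2) comes from handoff-prove-2's `WeilColumnBSplineContinuity` (p421408), so the theorems are hypothesis-free
beyond `P.Admissible qn`; `D2_on_Ioc` is the lane's hypothesis shape and `continuousOn_deriv_Θ` feeds `WeilColumnTruncationError`.
RH-free; nothing here bears on the truth of RH.
-/

set_option linter.dupNamespace false

noncomputable section

open MeasureTheory Set Complex Filter
open scoped Real FourierTransform Topology
open Literature.NumberTheory.LFunctions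

namespace Summit.RiemannHypothesis.RiemannHypothesis.Theorems.WeilColumn.ThetaMellin

/-! ## §2 The Fourier transform of `φ(y) = y·h′(y)` -/

/-- `𝓕(f + g) = 𝓕f + 𝓕g` pointwise, for integrable `f, g`. [folklore] -/
theorem fourier_add_apply {f g : ℝ → ℂ} (hf : Integrable f) (hg : Integrable g) (ξ : ℝ) :
    𝓕 (fun y => f y + g y) ξ = 𝓕 f ξ + 𝓕 g ξ := by
  rw [Real.fourier_real_eq_integral_exp_smul, Real.fourier_real_eq_integral_exp_smul, Real.fourier_real_eq_integral_exp_smul,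
    ← integral_add (integrable_fourierIntegrand hf ξ) (integrable_fourierIntegrand hg ξ)]
  refine integral_congr_ae (Eventually.of_forall fun v => ?_)
  simp only [smul_eq_mul]
  ring

/-- `𝓕(f − g) = 𝓕f − 𝓕g` pointwise, for integrable `f, g`. [folklore] -/
theorem fourier_sub_apply {f g : ℝ → ℂ} (hf : Integrable f) (hg : Integrable g) (ξ : ℝ) :
    𝓕 (fun y => f y - g y) ξ = 𝓕 f ξ - 𝓕 g ξ := by
  rw [Real.fourier_real_eq_integral_exp_smul, Real.fourier_real_eq_integral_exp_smul, Real.fourier_real_eq_integral_exp_smul,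
    ← integral_sub (integrable_fourierIntegrand hf ξ) (integrable_fourierIntegrand hg ξ)]
  refine integral_congr_ae (Eventually.of_forall fun v => ?_)
  simp only [smul_eq_mul]
  ring

/-- The shifted first moment `y ↦ y·ρ(y − s)` of an integrable, compactly supported density is integrable. [folklore] -/
theorem integrable_mulId_comp_sub {ρ : ℝ → ℂ} (hρ : Integrable ρ) {R : ℝ} (hsupp : Function.support ρ ⊆ Icc (-R) R) (s : ℝ) :
    Integrable fun y : ℝ => (y : ℂ) * ρ (y - s) := by
  have h := integrable_mulId_of_support (hρ.comp_sub_right s) (R := |R| + |s|) (by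
    intro y hy
    have hy' : ρ (y - s) ≠ 0 := hy
    have hmem := hsupp (Function.mem_support.mpr hy')
    constructor <;> nlinarith [hmem.1, hmem.2, le_abs_self R, neg_abs_le R, le_abs_self s, neg_abs_le s])
  exact h

/-- The pieces `S(s) := 𝓕[y·ρ(y−s)]` obey `‖S(s)(ξ)‖ ≤ ‖𝓕[y·ρ](ξ)‖ + |s|·‖𝓕ρ(ξ)‖`. [folklore] -/
theorem norm_fourier_mulId_comp_sub_le {ρ : ℝ → ℂ} (hρ : Integrable ρ) (hρ' : Integrable (mulId ρ)) (s ξ : ℝ) :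
    ‖𝓕 (fun y : ℝ => (y : ℂ) * ρ (y - s)) ξ‖ ≤ ‖𝓕 (mulId ρ) ξ‖ + |s| * ‖𝓕 ρ ξ‖ := by
  rw [fourier_mulId_comp_sub hρ hρ' s ξ, norm_mul, Complex.norm_exp_ofReal_mul_I, one_mul]
  refine (norm_add_le _ _).trans (le_of_eq ?_)
  rw [norm_mul, Complex.norm_real, Real.norm_eq_abs]

variable {c₁ m₀ c₂ ε α : ℝ} {m : ℕ}

/-- `φ = y·h′(y)` as the three-piece combination `(1+α)·yρ(y−m₀) − yρ(y−(c₂−ε)) − α·yρ(y−(c₁+ε))`. [folklore] -/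
theorem mulId_profileDeriv_eq (y : ℝ) :
    mulId (profileDeriv c₁ m₀ c₂ ε α m) y =
      ((1 + (α : ℂ)) * ((y : ℂ) * profileDensity ε m (y - m₀)) - (y : ℂ) * profileDensity ε m (y - (c₂ - ε)))
        - (α : ℂ) * ((y : ℂ) * profileDensity ε m (y - (c₁ + ε))) := by
  simp only [mulId, profileDeriv]
  ring

/-- The Fourier transform of `φ` in terms of the three shifted moments. [folklore] -/
theorem fourier_mulId_profileDeriv (hε : 0 ≤ ε) (ξ : ℝ) :
    𝓕 (mulId (profileDeriv c₁ m₀ c₂ ε α m)) ξ =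
      ((1 + (α : ℂ)) * 𝓕 (fun y : ℝ => (y : ℂ) * profileDensity ε m (y - m₀)) ξ
        - 𝓕 (fun y : ℝ => (y : ℂ) * profileDensity ε m (y - (c₂ - ε))) ξ)
        - (α : ℂ) * 𝓕 (fun y : ℝ => (y : ℂ) * profileDensity ε m (y - (c₁ + ε))) ξ := by
  have hρ : Integrable (profileDensity ε m) := integrable_bsplineDensity _ _
  have hsupp := support_bsplineDensity_subset (c := ε / m) (by positivity) (m - 1)
  have hi : ∀ s : ℝ, Integrable fun y : ℝ => (y : ℂ) * profileDensity ε m (y - s) := fun s =>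
    integrable_mulId_comp_sub hρ hsupp s
  set A : ℝ → ℂ := fun y : ℝ => (1 + (α : ℂ)) * ((y : ℂ) * profileDensity ε m (y - m₀)) with hA
  set B : ℝ → ℂ := fun y : ℝ => (y : ℂ) * profileDensity ε m (y - (c₂ - ε)) with hB
  set C : ℝ → ℂ := fun y : ℝ => (α : ℂ) * ((y : ℂ) * profileDensity ε m (y - (c₁ + ε))) with hC
  have e : mulId (profileDeriv c₁ m₀ c₂ ε α m) = fun y : ℝ => (A y - B y) - C y := funext fun y => by
    simp only [hA, hB, hC]; exact mulId_profileDeriv_eq y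
  have hAi : Integrable A := (hi m₀).const_mul _
  have hBi : Integrable B := hi _
  have hCi : Integrable C := (hi _).const_mul _
  have hABi : Integrable (fun y : ℝ => A y - B y) := hAi.sub hBi
  rw [e, fourier_sub_apply hABi hCi, fourier_sub_apply hAi hBi]
  have h1 : 𝓕 A ξ = (1 + (α : ℂ)) * 𝓕 (fun y : ℝ => (y : ℂ) * profileDensity ε m (y - m₀)) ξ := by
    rw [hA, fourier_const_mul]
  have h3 : 𝓕 C ξ = (α : ℂ) * 𝓕 (fun y : ℝ => (y : ℂ) * profileDensity ε m (y - (c₁ + ε))) ξ := by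
    rw [hC, fourier_const_mul]
  rw [h1, h3]

/-- **THETA-CERT §D2's `|φ̂|` bound**: for `φ(y) = y·h′(y)`, `m ≥ 1`, `ε > 0`, `0 ≤ c₁`, `c₁ + ε ≤ m₀ ≤ c₂ − ε`, `α ≥ 0`, `ξ ≠ 0`,
`‖𝓕φ(ξ)‖ ≤ (2+2α)·X^m·(c₂ + ε(1 + X))` with `X = m/(2πε|ξ|)` (`= 1/(2πc|ξ|)`, `c = ε/m`). [this seat, D2] -/
theorem norm_fourier_momentProfile_le (hm : 1 ≤ m) (hε : 0 < ε) (hc₁ : 0 ≤ c₁) (h2 : c₁ + ε ≤ m₀) (h1 : m₀ ≤ c₂ - ε)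
    (hα : 0 ≤ α) {ξ : ℝ} (hξ : ξ ≠ 0) :
    ‖𝓕 (mulId (profileDeriv c₁ m₀ c₂ ε α m)) ξ‖ ≤
      (2 + 2 * α) * (m / (2 * π * ε * |ξ|)) ^ m * (c₂ + ε * (1 + m / (2 * π * ε * |ξ|))) := by
  have hc : 0 < ε / m := div_pos hε (by exact_mod_cast hm)
  have hρ : Integrable (profileDensity ε m) := integrable_bsplineDensity _ _
  have hρ' : Integrable (mulId (profileDensity ε m)) := integrable_mulId_bsplineDensity hc.le _
  set X : ℝ := m / (2 * π * ε * |ξ|) with hX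
  have hX0 : 0 ≤ X := by positivity
  have hcX : 1 / (2 * π * (ε / m) * |ξ|) = X := by rw [hX]; field_simp
  have hk : ((m - 1 : ℕ) : ℝ) + 1 = m := by rw [Nat.cast_sub hm]; push_cast; ring
  -- the two elementary bounds
  have hB1 : ‖𝓕 (profileDensity ε m) ξ‖ ≤ X ^ m := by
    have := norm_fourier_bsplineDensity_le hc (m - 1) hξ
    rw [hcX, Nat.sub_add_cancel hm] at this
    exact this
  have hB2 : ‖𝓕 (mulId (profileDensity ε m)) ξ‖ ≤ ε * X ^ m * (1 + X) := by
    have := norm_fourier_mulId_bsplineDensity_le hc (m - 1) hξ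
    rw [hcX, hk] at this
    refine this.trans (le_of_eq ?_)
    have hpow : X ^ m = X ^ (m - 1) * X := by rw [← pow_succ, Nat.sub_add_cancel hm]
    rw [hpow, hX]
    field_simp
  -- each shifted piece
  have hS : ∀ s : ℝ, |s| ≤ c₂ → ‖𝓕 (fun y : ℝ => (y : ℂ) * profileDensity ε m (y - s)) ξ‖ ≤ ε * X ^ m * (1 + X) + c₂ * X ^ m := by
    intro s hs
    refine (norm_fourier_mulId_comp_sub_le hρ hρ' s ξ).trans ?_
    have := mul_le_mul hs hB1 (norm_nonneg _) (le_trans (abs_nonneg _) hs)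
    linarith
  have hs₁ : |m₀| ≤ c₂ := by rw [abs_of_nonneg (by linarith)]; linarith
  have hs₂ : |c₂ - ε| ≤ c₂ := by rw [abs_of_nonneg (by linarith)]; linarith
  have hs₃ : |c₁ + ε| ≤ c₂ := by rw [abs_of_nonneg (by linarith)]; linarith
  rw [fourier_mulId_profileDeriv hε.le]
  have hn1 : ‖(1 + (α : ℂ))‖ = 1 + α := by
    rw [show (1 + (α : ℂ)) = ((1 + α : ℝ) : ℂ) by push_cast; ring, Complex.norm_real, Real.norm_of_nonneg (by linarith)]
  have hnα : ‖(α : ℂ)‖ = α := by rw [Complex.norm_real, Real.norm_of_nonneg hα]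
  calc ‖((1 + (α : ℂ)) * 𝓕 (fun y : ℝ => (y : ℂ) * profileDensity ε m (y - m₀)) ξ
          - 𝓕 (fun y : ℝ => (y : ℂ) * profileDensity ε m (y - (c₂ - ε))) ξ)
          - (α : ℂ) * 𝓕 (fun y : ℝ => (y : ℂ) * profileDensity ε m (y - (c₁ + ε))) ξ‖
        ≤ (‖(1 + (α : ℂ))‖ * ‖𝓕 (fun y : ℝ => (y : ℂ) * profileDensity ε m (y - m₀)) ξ‖
          + ‖𝓕 (fun y : ℝ => (y : ℂ) * profileDensity ε m (y - (c₂ - ε))) ξ‖)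
          + ‖(α : ℂ)‖ * ‖𝓕 (fun y : ℝ => (y : ℂ) * profileDensity ε m (y - (c₁ + ε))) ξ‖ := by
          refine (norm_sub_le _ _).trans (add_le_add ((norm_sub_le _ _).trans (add_le_add ?_ le_rfl)) ?_)
          · rw [norm_mul]
          · rw [norm_mul]
    _ ≤ ((1 + α) * (ε * X ^ m * (1 + X) + c₂ * X ^ m) + (ε * X ^ m * (1 + X) + c₂ * X ^ m))
          + α * (ε * X ^ m * (1 + X) + c₂ * X ^ m) := by
          rw [hn1, hnα]
          gcongr
          · exact hS _ hs₁
          · exact hS _ hs₂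
          · exact hS _ hs₃
    _ = (2 + 2 * α) * X ^ m * (c₂ + ε * (1 + X)) := by ring

/-- **Zero mean of `φ`**: `𝓕φ(0) = 0` when `α·(m₀ − c₁ − ε) = c₂ − ε − m₀` (`∫ y h′(y) dy = −∫ h = 0`). [this seat, D2] -/
theorem fourier_momentProfile_zero (hm : 1 ≤ m) (hε : 0 ≤ ε) (hα : α * (m₀ - c₁ - ε) = c₂ - ε - m₀) :
    𝓕 (mulId (profileDeriv c₁ m₀ c₂ ε α m)) 0 = 0 := by
  have hc : 0 ≤ ε / m := by positivity
  have hρ : Integrable (profileDensity ε m) := integrable_bsplineDensity _ _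
  have hρ' : Integrable (mulId (profileDensity ε m)) := integrable_mulId_bsplineDensity hc _
  have hS : ∀ s : ℝ, 𝓕 (fun y : ℝ => (y : ℂ) * profileDensity ε m (y - s)) 0 =
      𝓕 (mulId (profileDensity ε m)) 0 + (s : ℂ) * 𝓕 (profileDensity ε m) 0 := by
    intro s
    rw [fourier_mulId_comp_sub hρ hρ' s 0]
    simp
  rw [fourier_mulId_profileDeriv hε, hS, hS, hS]
  have hα' : (α : ℂ) * ((m₀ : ℂ) - c₁ - ε) = (c₂ : ℂ) - ε - m₀ := by exact_mod_cast hα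
  push_cast
  linear_combination (𝓕 (profileDensity ε m) 0) * hα'

/-! ## §4 The lattice bound and the D2 majorant in the interface's names -/

/-- **Lattice-sum bound** (lattice form of p416577's `summable_tsum_norm_le_of_decay`): if `‖F(n/u)‖ ≤ D/|n|^{p+1}` for every
integer `n ≠ 0` (`p ≥ 1`, `D ≥ 0`, `u > 0`) and `F 0 = 0`, then `Σ_{n∈ℤ}‖F(n/u)‖ ≤ 2D·Σ_{n≥1} n^{−(p+1)}`. [folklore] -/
theorem summable_tsum_norm_le_of_lattice_bound {F : ℝ → ℂ} {D : ℝ} {p : ℕ} (hp : 1 ≤ p) (hD : 0 ≤ D) {u : ℝ} (hu : 0 < u)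
    (hF : ∀ n : ℤ, n ≠ 0 → ‖F (n / u)‖ ≤ D / |(n : ℝ)| ^ (p + 1)) (hF0 : F 0 = 0) :
    Summable (fun n : ℤ => ‖F (n / u)‖) ∧
      ∑' n : ℤ, ‖F (n / u)‖ ≤ 2 * D * ∑' n : ℕ, 1 / ((n : ℝ) + 1) ^ (p + 1) := by
  classical
  -- restrict F to the lattice (zero elsewhere): then the pure-power hypothesis of the tree lemma holds for every ξ ≠ 0
  set Fb : ℝ → ℂ := fun ξ => if ∃ n : ℤ, (n : ℝ) = ξ * u then F ξ else 0 with hFb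
  have hlat : ∀ n : ℤ, Fb (n / u) = F (n / u) := fun n => by
    have : ∃ k : ℤ, (k : ℝ) = (n : ℝ) / u * u := ⟨n, by field_simp⟩
    simp only [hFb, this, if_true]
  have hFb0 : Fb 0 = 0 := by
    have e := hlat 0; push_cast at e; rw [zero_div] at e; rw [e, hF0]
  have hdec : ∀ ξ : ℝ, ξ ≠ 0 → ‖Fb ξ‖ ≤ D / u ^ (p + 1) / |ξ| ^ (p + 1) := by
    intro ξ hξ
    by_cases hex : ∃ n : ℤ, (n : ℝ) = ξ * u
    · obtain ⟨n, hn⟩ := hex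
      have hξn : ξ = n / u := by rw [hn]; field_simp
      have hn0 : n ≠ 0 := by rintro rfl; simp at hn; rcases hn with h | h <;> [exact hξ h; exact hu.ne' h]
      rw [hξn, hlat n]
      refine (hF n hn0).trans (le_of_eq ?_)
      rw [abs_div, abs_of_pos hu, div_pow]
      field_simp
    · simp only [hFb, hex, if_false, norm_zero]; positivity
  obtain ⟨hs, hle⟩ := summable_tsum_norm_le_of_decay (F := Fb) (C := D / u ^ (p + 1)) hp hdec hFb0 hu
  simp only [hlat] at hs hle
  refine ⟨hs, hle.trans (le_of_eq ?_)⟩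
  field_simp

/-- The scaling identity behind D2's constant: `u⁻¹·2·(λK(mu/(2πελ))^{k+1})·S = 2(λ/u₁)KS·(m u₁/(2πελ))^{k+1}·(u/u₁)^k`
(`m = k+1`). [folklore] -/
theorem moment_scaling_identity (lam u u₁ ε K S : ℝ) (k : ℕ) (hu : u ≠ 0) (hu₁ : u₁ ≠ 0) (hlam : lam ≠ 0) (hε : ε ≠ 0) :
    u⁻¹ * (2 * (lam * K * ((((k + 1 : ℕ) : ℝ)) * u / (2 * π * ε * lam)) ^ (k + 1)) * S) =
      2 * (lam / u₁) * K * S * ((((k + 1 : ℕ) : ℝ)) / (2 * π * ε * lam / u₁)) ^ (k + 1) * (u / u₁) ^ k := by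
  simp only [div_pow]
  field_simp
  ring

namespace ThetaParams

variable (P : ThetaParams)

/-- `φ(y) = y·h′(y)` for the witness profile. -/
def phiMoment : ℝ → ℂ := mulId (profileDeriv P.c₁ P.m₀ P.c₂ P.ε P.α P.m)

/-- The smoothing density of an admissible row is continuous (handoff-prove-2's `continuous_bsplineDensity`, `m ≥ 2`). [folklore] -/
theorem continuous_profileDensity {qn : ℕ} (hP : P.Admissible qn) : Continuous (profileDensity P.ε P.m) := by
  have hm : 2 ≤ P.m := le_trans (by norm_num) hP.three_le
  have hε : 0 < P.ε := by have := hP.delta_pos; have := hP.c₂_pos; unfold ε; positivity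
  have hm0 : (0 : ℝ) < P.m := by exact_mod_cast (lt_of_lt_of_le (by norm_num) hm)
  exact continuous_bsplineDensity (div_pos hε hm0) (by omega)

/-- **The theta series of the witness is differentiable on `(0, ∞)` and `u·Θ′(u) = Σ_{n≥1} φ(nu/λ)`** (given B-spline continuity).
[this seat, D2] -/
theorem hasDerivAt_Θ {qn : ℕ} (hP : P.Admissible qn) {u : ℝ} (hu : 0 < u) :
    ∃ D : ℂ, HasDerivAt P.Θ D u ∧ (u : ℂ) * D = thetaSum (fun z : ℝ => P.phiMoment (z / P.lam)) u := by
  have hρ := P.continuous_profileDensity hP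
  have hm : 1 ≤ P.m := le_trans (by norm_num) hP.three_le
  have hε : 0 < P.ε := by have := hP.delta_pos; have := hP.c₂_pos; unfold ε; positivity
  have hlam : 0 < P.lam := by have := hP.c₂_pos; unfold lam; positivity
  have h1 : P.m₀ ≤ P.c₂ - P.ε := hP.seed₂.le
  have h2 : P.c₁ + P.ε ≤ P.m₀ := hP.seed₁.le
  have hh : ∀ y, HasDerivAt P.h (profileDeriv P.c₁ P.m₀ P.c₂ P.ε P.α P.m y) y := fun y => hasDerivAt_profile h1 h2 hρ y
  have hz : ∀ y, y ∉ Icc P.c₁ P.c₂ → P.h y = 0 := fun y hy =>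
    Function.notMem_support.mp fun hmem => hy (support_profile_subset (α := P.α) hm hε.le h1 h2 hmem)
  have hz' : ∀ y, y ∉ Icc P.c₁ P.c₂ → profileDeriv P.c₁ P.m₀ P.c₂ P.ε P.α P.m y = 0 := fun y hy =>
    profileDeriv_eq_zero hm hε.le h1 h2 hy
  have hle : P.c₁ ≤ P.c₂ := by linarith
  obtain ⟨D, hD, hmul⟩ := hasDerivAt_thetaSum_scaled hh (continuous_profileDeriv _ _ _ _ _ hρ) hP.c₁_pos hle hz hz' hlam hu
  exact ⟨D, hD, by rw [hmul]; rfl⟩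

/-- **D2 — THE DERIVATIVE MAJORANT in the interface's names**: for `0 < u ≤ u₁`, `‖u·Θ′(u)‖ ≤ M₁·(u/u₁)^{m−1}`
(THETA-CERT-cc6 §D2; `M₁ = 2(λ/u₁)Σ|cᵢ|(c₂ + ε(1 + m/ζ⋆))ζ(m)(m/ζ⋆)^m`), GIVEN B-spline continuity. [this seat, D2] -/
theorem norm_mul_deriv_Θ_le {qn : ℕ} (hP : P.Admissible qn) {u : ℝ} (hu : 0 < u)
    (hu₁ : u ≤ P.u₁) : ‖(u : ℂ) * deriv P.Θ u‖ ≤ P.M₁ * (u / P.u₁) ^ (P.m - 1) := by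
  have hρ := P.continuous_profileDensity hP
  have hm3 := hP.three_le
  have hm : 1 ≤ P.m := le_trans (by norm_num) hm3
  have hε : 0 < P.ε := by have := hP.delta_pos; have := hP.c₂_pos; unfold ε; positivity
  have hlam : 0 < P.lam := by have := hP.c₂_pos; unfold lam; positivity
  have hu₁pos : 0 < P.u₁ := Real.exp_pos _
  have h1 : P.m₀ ≤ P.c₂ - P.ε := hP.seed₂.le
  have h2 : P.c₁ + P.ε ≤ P.m₀ := hP.seed₁.le
  have hα : 0 ≤ P.α := div_nonneg (by linarith [hP.seed₂]) (by linarith [hP.seed₁])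
  have hc₁ε : 0 ≤ P.c₁ + P.ε := by linarith [hP.c₁_pos]
  -- Θ′ and the moment series
  obtain ⟨D, hD, hmul⟩ := P.hasDerivAt_Θ hP hu
  rw [hD.deriv, hmul]
  -- the moment profile scaled by λ, as in D1
  set φ : ℝ → ℂ := P.phiMoment with hφ
  set Φ : ℝ → ℂ := fun y => φ (P.lam⁻¹ * y) with hΦ
  have eΦ : (fun z : ℝ => P.phiMoment (z / P.lam)) = Φ := by
    funext z; simp only [hΦ, hφ, div_eq_inv_mul]
  rw [eΦ]
  -- hypotheses of the Poisson majorant for Φ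
  have hφc : Continuous φ := Complex.continuous_ofReal.mul (continuous_profileDeriv _ _ _ _ _ hρ)
  have hΦc : Continuous Φ := hφc.comp (continuous_const.mul continuous_id)
  have hφz : ∀ y, y ∉ Icc P.c₁ P.c₂ → φ y = 0 := fun y hy => by
    simp only [hφ, phiMoment, mulId, profileDeriv_eq_zero hm hε.le h1 h2 hy, mul_zero]
  have hφsupp : HasCompactSupport φ :=
    HasCompactSupport.of_support_subset_isCompact isCompact_Icc fun y hy => by
      by_contra h; exact hy (hφz y h)
  have hΦsupp : HasCompactSupport Φ := by
    have := hφsupp.comp_homeomorph (Homeomorph.mulLeft₀ P.lam⁻¹ (inv_ne_zero hlam.ne'))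
    rw [hΦ]; exact this
  have hΦneg : ∀ y ≤ 0, Φ y = 0 := fun y hy => hφz _ fun hmem => by
    have : P.lam⁻¹ * y ≤ 0 := mul_nonpos_of_nonneg_of_nonpos (inv_nonneg.2 hlam.le) hy
    linarith [hmem.1, hP.c₁_pos]
  -- Fourier transform of Φ: dilation + the moment bound
  have hFΦ : ∀ ξ : ℝ, 𝓕 Φ ξ = (P.lam : ℂ) * 𝓕 φ (ξ * P.lam) := by
    intro ξ
    have := fourier_comp_mul φ (inv_pos.2 hlam) ξ
    rw [hΦ, this, div_inv_eq_mul, Complex.ofReal_inv, inv_inv]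
  have hF0 : 𝓕 Φ 0 = 0 := by
    rw [hFΦ, zero_mul, hφ, phiMoment, fourier_momentProfile_zero hm hε.le, mul_zero]
    have hden : P.m₀ - P.c₁ - P.ε ≠ 0 := by linarith [hP.seed₁]
    unfold α; field_simp
  -- lattice bound: for |n| ≥ 1 and u ≤ u₁, X(n lam/u) ≤ m/zstar
  set K : ℝ := P.csum * (P.c₂ + P.ε * (1 + P.m / P.zstar)) with hK
  set Dc : ℝ := P.lam * K * (P.m * u / (2 * π * P.ε * P.lam)) ^ P.m with hDc
  have hK0 : 0 ≤ K := by
    have : 0 ≤ P.csum := by unfold csum; linarith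
    have : 0 < P.zstar := by unfold zstar; positivity
    have := hP.c₂_pos
    positivity
  have hDc0 : 0 ≤ Dc := by positivity
  have hlat : ∀ n : ℤ, n ≠ 0 → ‖𝓕 Φ (n / u)‖ ≤ Dc / |(n : ℝ)| ^ (P.m - 1 + 1) := by
    intro n hn
    rw [Nat.sub_add_cancel hm]
    have hn1 : (1 : ℝ) ≤ |(n : ℝ)| := by exact_mod_cast Int.one_le_abs hn
    have hξ : (n : ℝ) / u * P.lam ≠ 0 := by
      have : (n : ℝ) ≠ 0 := by exact_mod_cast hn
      positivity
    rw [hFΦ, norm_mul, Complex.norm_real, Real.norm_of_nonneg hlam.le]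
    have hb := norm_fourier_momentProfile_le hm hε hP.c₁_pos.le h2 h1 hα hξ
    -- X at this frequency
    set X : ℝ := P.m / (2 * π * P.ε * |(n : ℝ) / u * P.lam|) with hX
    have hXe : X = (P.m * u / (2 * π * P.ε * P.lam)) / |(n : ℝ)| := by
      rw [hX, abs_mul, abs_div, abs_of_pos hu, abs_of_pos hlam]; field_simp
    have hX0 : 0 ≤ X := by positivity
    have hXle : X ≤ P.m / P.zstar := by
      rw [hXe, zstar, div_le_div_iff₀ (by positivity) (by unfold zstar at *; positivity)]
      -- m u/(2π ε lam) · zstar ≤ m · |n|  with zstar = 2π ε lam / u₁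
      have : P.m * u / (2 * π * P.ε * P.lam) * (2 * π * P.ε * P.lam / P.u₁) = P.m * (u / P.u₁) := by field_simp
      rw [this]
      have hm0 : (0 : ℝ) ≤ P.m := by positivity
      have : u / P.u₁ ≤ 1 := (div_le_one hu₁pos).mpr hu₁
      nlinarith
    have hcs : (2 + 2 * P.α) = P.csum := by unfold csum; ring
    calc P.lam * ‖𝓕 φ ((n : ℝ) / u * P.lam)‖
          ≤ P.lam * ((2 + 2 * P.α) * X ^ P.m * (P.c₂ + P.ε * (1 + X))) := mul_le_mul_of_nonneg_left hb hlam.le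
      _ ≤ P.lam * (P.csum * X ^ P.m * (P.c₂ + P.ε * (1 + P.m / P.zstar))) := by
          rw [hcs]
          have hcs0 : 0 ≤ P.csum := by unfold csum; linarith
          have hin : P.c₂ + P.ε * (1 + X) ≤ P.c₂ + P.ε * (1 + P.m / P.zstar) := by nlinarith [hXle, hε]
          exact mul_le_mul_of_nonneg_left (mul_le_mul_of_nonneg_left hin (by positivity)) hlam.le
      _ = Dc / |(n : ℝ)| ^ P.m := by
          rw [hDc, hK, hXe, div_pow]
          field_simp
  obtain ⟨hsum, hle⟩ := summable_tsum_norm_le_of_lattice_bound (p := P.m - 1) (by omega) hDc0 hu hlat hF0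
  -- Poisson majorant
  have hP1 := norm_thetaSum_le_inv_mul_tsum hΦc hΦsupp hΦneg hu hsum
  rw [thetaSum]
  refine hP1.trans ?_
  rw [Nat.sub_add_cancel hm] at hle
  calc u⁻¹ * ∑' n : ℤ, ‖𝓕 Φ (n / u)‖ ≤ u⁻¹ * (2 * Dc * ∑' n : ℕ, 1 / ((n : ℝ) + 1) ^ P.m) :=
        mul_le_mul_of_nonneg_left hle (inv_nonneg.2 hu.le)
    _ = P.M₁ * (u / P.u₁) ^ (P.m - 1) := by
        obtain ⟨k, hk⟩ : ∃ k : ℕ, P.m = k + 1 := ⟨P.m - 1, (Nat.sub_add_cancel hm).symm⟩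
        have hM₁ : P.M₁ = 2 * (P.lam / P.u₁) * K * zetaTail P.m * ((P.m : ℝ) / P.zstar) ^ P.m := by
          simp only [M₁, hK]; ring
        have hz : P.zstar = 2 * π * P.ε * P.lam / P.u₁ := rfl
        rw [hM₁, hDc, hz, zetaTail, hk, Nat.add_sub_cancel]
        exact moment_scaling_identity P.lam u P.u₁ P.ε K _ k hu.ne' hu₁pos.ne' hlam.ne' hε.ne'

/-- The witness theta series is differentiable on `(0, ∞)`: `HasDerivAt Θ (deriv Θ u) u`. [this seat, D2] -/
theorem hasDerivAt_deriv_Θ {qn : ℕ} (hP : P.Admissible qn) {u : ℝ} (hu : 0 < u) : HasDerivAt P.Θ (deriv P.Θ u) u := by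
  obtain ⟨D, hD, -⟩ := P.hasDerivAt_Θ hP hu
  exact hD.differentiableAt.hasDerivAt

/-- **D2 in the lane's shape** (hypothesis `hM₁` of `WeilColumnThetaTailNorms` / `WeilColumnTruncationError` with `Θ′ := deriv Θ`). -/
theorem D2_on_Ioc {qn : ℕ} (hP : P.Admissible qn) :
    ∀ u ∈ Ioc (0 : ℝ) P.u₁, ‖(u : ℂ) * deriv P.Θ u‖ ≤ P.M₁ * (u / P.u₁) ^ (P.m - 1) :=
  fun _ hu => P.norm_mul_deriv_Θ_le hP hu.1 hu.2

/-- `deriv Θ` is continuous on `(0, ∞)` (`u·Θ′(u)` is the theta series of the continuous compactly supported `φ(·/λ)`). -/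
theorem continuousOn_deriv_Θ {qn : ℕ} (hP : P.Admissible qn) : ContinuousOn (deriv P.Θ) (Ioi 0) := by
  have hρ := P.continuous_profileDensity hP
  have hm : 1 ≤ P.m := le_trans (by norm_num) hP.three_le
  have hε : 0 < P.ε := by have := hP.delta_pos; have := hP.c₂_pos; unfold ε; positivity
  have hlam : 0 < P.lam := by have := hP.c₂_pos; unfold lam; positivity
  have hle : P.c₁ ≤ P.c₂ := by linarith [hP.seed₁, hP.seed₂]
  -- the moment series is continuous on (0, ∞)
  have hΦ : ProfileHyp (fun z : ℝ => P.phiMoment (z / P.lam)) (P.lam * P.c₁) (P.lam * P.c₂) := by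
    refine profileHyp_scaled (h := P.phiMoment) ?_ hP.c₁_pos hle (fun y hy => ?_) hlam
    · exact Complex.continuous_ofReal.mul (continuous_profileDeriv _ _ _ _ _ hρ)
    · simp [phiMoment, mulId, profileDeriv_eq_zero hm hε.le hP.seed₂.le hP.seed₁.le hy]
  have hcont := hΦ.continuousOn_thetaSum
  have heq : ∀ u ∈ Ioi (0 : ℝ), deriv P.Θ u = (u : ℂ)⁻¹ * thetaSum (fun z : ℝ => P.phiMoment (z / P.lam)) u := by
    intro u hu
    obtain ⟨D, hD, hmul⟩ := P.hasDerivAt_Θ hP hu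
    have hu0 : (u : ℂ) ≠ 0 := by exact_mod_cast (ne_of_gt hu)
    rw [hD.deriv, ← hmul, ← mul_assoc, inv_mul_cancel₀ hu0, one_mul]
  refine ContinuousOn.congr ?_ heq
  exact ContinuousOn.mul (Continuous.continuousOn (by fun_prop) |>.inv₀ fun u hu => by exact_mod_cast (ne_of_gt hu)) hcont

end ThetaParams

end Summit.RiemannHypothesis.RiemannHypothesis.Theorems.WeilColumn.ThetaMellin
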